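import Summits.BirchSwinnertonDyer.BirchSwinnertonDyer.Theorems.SchneiderFreeAdditiveX3PoitouTateIdeleProjection
import HarnessLib

/-!
# The presentation road at the CANONICAL level: Milne I Thm. 4.10 (b) `Ker γ¹ ⊆ Im β¹` for THE invariant maps
# `LocalInvariants.canonical K n` (every admissible `S`, every finite `n`-torsion `M`) from the sign-free E-side reciprocity
# sum; hence `SelmerComplement (canonical K n)` and the five-conjunct fact `poitouTate_selmerStructure_duality_real K`

Cell `bsd-schneider`, seat `door-c4` g18.  Crux `stmt-BirchSwinnertonDyer-19295` `AnticycControlAdditiveK` (control corner;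
19538 ControlFacts (i) = hE).  Theorems only; no definition, no named fact, no instance, no `sorry`.

WHY.  door-c5 g17's `poitouTate_selmerStructure_duality_of_reciprocitySum` (and door-c6's `…_of_globalTerms_of_imp`,
`…_of_assembly`, `…_of_ideleProjection`) conclude the EXISTENTIAL named fact `poitouTate_selmerStructure_duality K` (some family
of invariant maps with the four properties).  Two kinds of consumer need more:
* the `Ш²`-readout road to PT2 = `poitouTate_sha_tateDual K` (bsd-wall chl-p2 `shaTwo_tateDual_of_presentation_readout`, door-c5
  g18, item 20462 / K4 24200) takes `hcomp : (LocalInvariants.canonical K n).SelmerComplement` — the property OF THE CANONICAL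
  FAMILY, which an existential cannot supply;
* the real-place consumers (bsd-wall tp2-p3 `sha_tateDual_of_readout_real`, b2b-bsdres O1 at `p = 2`) take the five-conjunct fact
  `poitouTate_selmerStructure_duality_real K` (`… ∧ InjectiveAtRealPlaces`), again a statement about the family's behaviour at
  the real places — true for the canonical family (`LocalInvariants.canonical_injectiveAtRealPlaces`) but not derivable from the
  four-conjunct existential for a general `K`.
The road's internals ARE canonical-level (`middleExact_allPlaces_tateDual_of_ideleProjection`, `middleExact_canonical_of_allPlaces_tateDual`,
`selmerComplement_canonical_of_middleExact_allLevels`); this file re-threads the last step so that both outputs are available from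
the SAME input as `…_of_reciprocitySum`:

* **`middleExact_canonical_of_reciprocitySum'`** (any `inv` with door-c4's `TateDualityHypotheses (classBarD K) inv`) /
  **`middleExact_canonical_of_reciprocitySum`** (`inv := classBarInv K`): the `hE` hypothesis of
  `poitouTate_selmerStructure_duality_of_middleExact_canonical` — Milne I Thm. 4.10 (b), `r = 1`, for THE invariant maps, at every
  level, every admissible `S`, every finite `n`-torsion `M` — from the sign-free reciprocity sum (π := `IdeleReadout.ideleProjection K`,
  hAsm := `IdeleReadout.ideleAssembly`, κ from `exists_bidual_intertwining`).
* **`selmerComplement_canonical_of_reciprocitySum`**, **`poitouTate_selmerStructure_duality_real_of_reciprocitySum`** (the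
  five-conjunct fact, witnessed by the canonical family); door-c5's four-conjunct conclusion follows from it by
  `poitouTate_selmerStructure_duality_of_real` (not restated).

HONEST FRAMING: a reduction (theorems with the displayed hypothesis `hE`); the reciprocity sum itself is NOT proved here (its
E-side package is door-c6 g18 (L1) + door-c4 g18 `…ReciprocityGeneralBase`); no case of Poitou–Tate or BSD is proved; crux 19295
stays open behind hE.

## References
* J. S. Milne, *Arithmetic Duality Theorems* (2nd ed. 2006), I Thm. 4.10 (b) (proof, p. 58), Lemma 4.13, Thm. 1.8, Ex. 1.6 (c),
  Thm. 2.13. [MilneADT2006]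
* B. Howard, Compositio Math. 140 (2004), Thm. 2.1.11. [Howard2004HeegnerKolyvagin]
* J. W. S. Cassels, A. Fröhlich (eds.), *Algebraic Number Theory* (1967), Ch. VII (J. Tate) §11.2 (bis). [CasselsFrohlichANT1967]
-/

noncomputable section

open Function NumberField IsDedekindDomain CategoryTheory CategoryTheory.Abelian
open scoped NumberField ContRepresentation

-- the summit's nested namespace `Summit.BirchSwinnertonDyer.BirchSwinnertonDyer.…` (layout D-0017) trips the linter
set_option linter.dupNamespace false

namespace Summit.BirchSwinnertonDyer.BirchSwinnertonDyer.Theorems.SchneiderFreeAdditiveX3.PoitouTateReduction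

open Field
open Literature.NumberTheory.GaloisRepresentations Literature.NumberTheory.GaloisCohomology
open Literature.NumberTheory.GaloisRepresentations.DiscreteGaloisModule (mu TateDual tateDual
  localTatePairingZMod unramifiedSubgroup)
open Literature.Algebra.Homology Literature.Algebra.Homology.DiscreteRep Literature.Algebra.Homology.ExtPresentation
open Literature.NumberTheory.GaloisRepresentations.IdeleClassBar (classBarD classBarInv tateDualityHypotheses_classBarD_classBarInv)
open Literature.NumberTheory.GaloisRepresentations.FreePresentation (presentationComplex presentationComplex_shortExact
  presModule₁ presModule₂ presIncl presProj pres_isSES moduleFinite_presModule₁ moduleFinite_presModule₂)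
open Literature.NumberTheory.GaloisRepresentations.HomDual (IdeleProjection readout readoutInvariant localReadout
  readout_eq_localReadout charZero_of_algebra equivariantMap restrictIntertwining isSES_restrict)
open Literature.NumberTheory.GaloisRepresentations.DGMBridge (LCarrier)
open Literature.AnabelianGeometry.AbsoluteAnabelian.Prop121vii (zmodToQmodZ brauerInvariantEquiv)

variable {K : Type} [Field K] [NumberField K]
variable (inv : Abelian.Ext (triv (Γ := absoluteGaloisGroup K) ℤ) (classBarD K) 2 →+ AddCircle (1 : ℚ))

/-- **Milne I Thm. 4.10 (b), `r = 1`, `Ker γ¹ ⊆ Im β¹` for THE canonical invariant maps — at every level `n`, every admissible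
finite set of places `S ⊇ {v ∣ ∞}` and every finite `n`-torsion `M` — from Tate duality for `(Γ_K, C̄, inv)` and the SIGN-FREE
E-side reciprocity sum for THE idèle projections** (door-c6's road `middleExact_allPlaces_tateDual_of_ideleProjection` with
(R3) := door-c5's `ideleAssembly` through `exists_readout_eq_of_assembly` and (R4) := `hR4_of_globalTerms_of_imp`, then the
all-places ⟹ every-`S` reduction `middleExact_canonical_of_allPlaces_tateDual`).  This is the `hE` input of
`poitouTate_selmerStructure_duality_of_middleExact_canonical`, i.e. the canonical-level content behind door-c5's
`poitouTate_selmerStructure_duality_of_reciprocitySum'`.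
[cite: MilneADT2006, Ch. I, Thm. 4.10 (b) (proof, p. 58), Lemma 4.13, Thm. 1.8][cite: CasselsFrohlichANT1967, Ch. VII §11.2 (bis)] -/
theorem middleExact_canonical_of_reciprocitySum' (hT : TateDualityHypotheses (classBarD K) inv)
    (hE : ∀ (n : ℕ) [NeZero n],
      ∀ ⦃M : Type⦄ [AddCommGroup M] [TopologicalSpace M] [DiscreteTopology M] [Finite M] [Finite (TateDual K M n)]
      (ρ₀ : DiscreteGaloisModule K M) (hM : ∀ m : M, n • m = 0)
      (ι : ρ₀.toContRepresentation →ⁱL ((ρ₀.tateDual n).tateDual n).toContRepresentation),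
      (∀ (m : M) (f : TateDual K M n), ι m f = f m) →
      ∀ (f : (presentationComplex ρ₀).X₁ ⟶ (ideleClassLimitShortComplex K).X₂)
        (ŷ : Abelian.Ext (triv (Γ := absoluteGaloisGroup K) ℤ) (presentationComplex ρ₀).X₃ 1) (T₀ : Finset (Place K)),
        ∃ (x : galoisCohomology ρ₀ 1) (Tx : Finset (Place K)), T₀ ⊆ Tx ∧
          (∀ v : HeightOneSpectrum (𝓞 K), (Sum.inr v : Place K) ∉ Tx →
            galoisCohomology.localization ρ₀ (Sum.inr v) 1 x ∈ unramifiedSubgroup (GaloisRep.toLocal v ρ₀) 1) ∧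
          ∀ T' : Finset (Place K), Tx ⊆ T' →
            (∑ v ∈ T', Sum.elim
              (fun w : InfinitePlace K => zmodToQmodZ n
                (localTatePairingZMod (ρ₀.tateDual n) n (Sum.inl w) (LocalInvariants.canonical K n (Sum.inl w))
                  (readout ρ₀ n hM (IdeleReadout.ideleProjection K (Sum.inl w)) f)
                  (galoisCohomology.localization ((ρ₀.tateDual n).tateDual n) (Sum.inl w) 1
                    (galoisCohomology.map ι 1 x))))
              (fun v : HeightOneSpectrum (𝓞 K) =>
                haveI := moduleFinite_presModule₁ ρ₀
                haveI : CharZero (v.adicCompletion K) := charZero_of_algebra (K := K) (v.adicCompletion K);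
                - brauerInvariantEquiv (v.adicCompletion K)
                  (cohomologyMap (toTopRepHom ((presModule₁ ρ₀).restrictField (v.adicCompletion K))
                      (DiscreteGaloisModule.units (v.adicCompletion K))
                      (equivariantMap ((presModule₁ ρ₀).restrictField (v.adicCompletion K))
                        (DiscreteGaloisModule.units (v.adicCompletion K))
                        (readoutInvariant (IdeleReadout.ideleProjection K (Sum.inr v)) (presentationComplex ρ₀).X₁ f))) 2
                    (galoisCohomology.res (presModule₁ ρ₀) (v.adicCompletion K) 2 ((pres_isSES ρ₀).δ₁ x))))
              v) = 0 →
            inv (ŷ.comp (boundary (presentationComplex_shortExact ρ₀) (classBarD K)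
              (f ≫ (ideleClassLimitShortComplex K).g)) (rfl : 1 + 1 = 2)) = 0) :
    ∀ (n : ℕ) [NeZero n],
      ∀ ⦃M : Type⦄ [AddCommGroup M] [TopologicalSpace M] [DiscreteTopology M] [Finite M]
      (ρ : DiscreteGaloisModule K M), (∀ m : M, n • m = 0) →
      ∀ S : Finset (Place K), (∀ w : InfinitePlace K, (Sum.inl w : Place K) ∈ S) →
        (∀ v : HeightOneSpectrum (𝓞 K), (Sum.inr v : Place K) ∉ S →
          ((n : ℕ) : 𝓞 K) ∉ v.asIdeal ∧ GaloisRep.IsUnramifiedAt v ρ) →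
        ∀ t : Π v : Place K, galoisCohomology (ρ.toLocal v) 1,
          (∀ y : galoisCohomology (ρ.tateDual n) 1,
            (∀ v : HeightOneSpectrum (𝓞 K), (Sum.inr v : Place K) ∉ S →
              galoisCohomology.localization (ρ.tateDual n) (Sum.inr v) 1 y ∈
                unramifiedSubgroup (GaloisRep.toLocal v (ρ.tateDual n)) 1) →
            ∑ v ∈ S, localTatePairingZMod ρ n v (LocalInvariants.canonical K n v) (t v)
              (galoisCohomology.localization (ρ.tateDual n) v 1 y) = 0) →
          ∃ x : galoisCohomology ρ 1,
            (∀ v : HeightOneSpectrum (𝓞 K), (Sum.inr v : Place K) ∉ S →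
              galoisCohomology.localization ρ (Sum.inr v) 1 x ∈
                unramifiedSubgroup (GaloisRep.toLocal v ρ) 1) ∧
            ∀ v ∈ S, galoisCohomology.localization ρ v 1 x = t v := by
  intro n _ M _ _ _ _ ρ hM S hinf hS t horth
  haveI := DiscreteGaloisModule.TateDual.finite K M n
  refine middleExact_canonical_of_allPlaces_tateDual ρ hM ?_ hinf hS t horth
  obtain ⟨ι, κ, hι, hκι, hικ⟩ := exists_bidual_intertwining (n := n) ρ hM
  have hκ : ∀ (Φ : TateDual K (TateDual K M n) n) (g : TateDual K M n), Φ g = g (κ Φ) := fun Φ g => by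
    conv_lhs => rw [← hικ Φ]
    exact hι (κ Φ) g
  exact middleExact_allPlaces_tateDual_of_ideleProjection inv hT (IdeleReadout.ideleProjection K) ρ hM
    (exists_readout_eq_of_assembly (IdeleReadout.ideleProjection K) ρ hM (IdeleReadout.ideleAssembly (K := K) n ρ hM))
    (hR4_of_globalTerms_of_imp inv (IdeleReadout.ideleProjection K) ρ hM ι κ hκι hκ (hE n ρ hM ι hι))

/-- **The same for `inv := classBarInv K`** (door-c4's record `tateDualityHypotheses_classBarD_classBarInv`).
[cite: MilneADT2006, Ch. I, Thm. 4.10 (b) (proof, p. 58), Thm. 1.8][cite: CasselsFrohlichANT1967, Ch. VII §11.2 (bis)] -/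
theorem middleExact_canonical_of_reciprocitySum
    (hE : ∀ (n : ℕ) [NeZero n],
      ∀ ⦃M : Type⦄ [AddCommGroup M] [TopologicalSpace M] [DiscreteTopology M] [Finite M] [Finite (TateDual K M n)]
      (ρ₀ : DiscreteGaloisModule K M) (hM : ∀ m : M, n • m = 0)
      (ι : ρ₀.toContRepresentation →ⁱL ((ρ₀.tateDual n).tateDual n).toContRepresentation),
      (∀ (m : M) (f : TateDual K M n), ι m f = f m) →
      ∀ (f : (presentationComplex ρ₀).X₁ ⟶ (ideleClassLimitShortComplex K).X₂)
        (ŷ : Abelian.Ext (triv (Γ := absoluteGaloisGroup K) ℤ) (presentationComplex ρ₀).X₃ 1) (T₀ : Finset (Place K)),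
        ∃ (x : galoisCohomology ρ₀ 1) (Tx : Finset (Place K)), T₀ ⊆ Tx ∧
          (∀ v : HeightOneSpectrum (𝓞 K), (Sum.inr v : Place K) ∉ Tx →
            galoisCohomology.localization ρ₀ (Sum.inr v) 1 x ∈ unramifiedSubgroup (GaloisRep.toLocal v ρ₀) 1) ∧
          ∀ T' : Finset (Place K), Tx ⊆ T' →
            (∑ v ∈ T', Sum.elim
              (fun w : InfinitePlace K => zmodToQmodZ n
                (localTatePairingZMod (ρ₀.tateDual n) n (Sum.inl w) (LocalInvariants.canonical K n (Sum.inl w))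
                  (readout ρ₀ n hM (IdeleReadout.ideleProjection K (Sum.inl w)) f)
                  (galoisCohomology.localization ((ρ₀.tateDual n).tateDual n) (Sum.inl w) 1
                    (galoisCohomology.map ι 1 x))))
              (fun v : HeightOneSpectrum (𝓞 K) =>
                haveI := moduleFinite_presModule₁ ρ₀
                haveI : CharZero (v.adicCompletion K) := charZero_of_algebra (K := K) (v.adicCompletion K);
                - brauerInvariantEquiv (v.adicCompletion K)
                  (cohomologyMap (toTopRepHom ((presModule₁ ρ₀).restrictField (v.adicCompletion K))
                      (DiscreteGaloisModule.units (v.adicCompletion K))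
                      (equivariantMap ((presModule₁ ρ₀).restrictField (v.adicCompletion K))
                        (DiscreteGaloisModule.units (v.adicCompletion K))
                        (readoutInvariant (IdeleReadout.ideleProjection K (Sum.inr v)) (presentationComplex ρ₀).X₁ f))) 2
                    (galoisCohomology.res (presModule₁ ρ₀) (v.adicCompletion K) 2 ((pres_isSES ρ₀).δ₁ x))))
              v) = 0 →
            classBarInv K (ŷ.comp (boundary (presentationComplex_shortExact ρ₀) (classBarD K)
              (f ≫ (ideleClassLimitShortComplex K).g)) (rfl : 1 + 1 = 2)) = 0) :
    ∀ (n : ℕ) [NeZero n],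
      ∀ ⦃M : Type⦄ [AddCommGroup M] [TopologicalSpace M] [DiscreteTopology M] [Finite M]
      (ρ : DiscreteGaloisModule K M), (∀ m : M, n • m = 0) →
      ∀ S : Finset (Place K), (∀ w : InfinitePlace K, (Sum.inl w : Place K) ∈ S) →
        (∀ v : HeightOneSpectrum (𝓞 K), (Sum.inr v : Place K) ∉ S →
          ((n : ℕ) : 𝓞 K) ∉ v.asIdeal ∧ GaloisRep.IsUnramifiedAt v ρ) →
        ∀ t : Π v : Place K, galoisCohomology (ρ.toLocal v) 1,
          (∀ y : galoisCohomology (ρ.tateDual n) 1,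
            (∀ v : HeightOneSpectrum (𝓞 K), (Sum.inr v : Place K) ∉ S →
              galoisCohomology.localization (ρ.tateDual n) (Sum.inr v) 1 y ∈
                unramifiedSubgroup (GaloisRep.toLocal v (ρ.tateDual n)) 1) →
            ∑ v ∈ S, localTatePairingZMod ρ n v (LocalInvariants.canonical K n v) (t v)
              (galoisCohomology.localization (ρ.tateDual n) v 1 y) = 0) →
          ∃ x : galoisCohomology ρ 1,
            (∀ v : HeightOneSpectrum (𝓞 K), (Sum.inr v : Place K) ∉ S →
              galoisCohomology.localization ρ (Sum.inr v) 1 x ∈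
                unramifiedSubgroup (GaloisRep.toLocal v ρ) 1) ∧
            ∀ v ∈ S, galoisCohomology.localization ρ v 1 x = t v :=
  middleExact_canonical_of_reciprocitySum' (classBarInv K) (tateDualityHypotheses_classBarD_classBarInv K) hE

/-- **`SelmerComplement` OF THE CANONICAL FAMILY at every level from the sign-free reciprocity sum** — the input `hcomp` of the
`Ш²`-readout road to `poitouTate_sha_tateDual` (bsd-wall chl-p2 / door-c5 g18).
[cite: MilneADT2006, Ch. I, Thm. 4.10 (b)][cite: Howard2004HeegnerKolyvagin, Thm. 2.1.11 (arXiv:1202.6340 p. 6)] -/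
theorem selmerComplement_canonical_of_reciprocitySum
    (hE : ∀ (n : ℕ) [NeZero n],
      ∀ ⦃M : Type⦄ [AddCommGroup M] [TopologicalSpace M] [DiscreteTopology M] [Finite M] [Finite (TateDual K M n)]
      (ρ₀ : DiscreteGaloisModule K M) (hM : ∀ m : M, n • m = 0)
      (ι : ρ₀.toContRepresentation →ⁱL ((ρ₀.tateDual n).tateDual n).toContRepresentation),
      (∀ (m : M) (f : TateDual K M n), ι m f = f m) →
      ∀ (f : (presentationComplex ρ₀).X₁ ⟶ (ideleClassLimitShortComplex K).X₂)
        (ŷ : Abelian.Ext (triv (Γ := absoluteGaloisGroup K) ℤ) (presentationComplex ρ₀).X₃ 1) (T₀ : Finset (Place K)),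
        ∃ (x : galoisCohomology ρ₀ 1) (Tx : Finset (Place K)), T₀ ⊆ Tx ∧
          (∀ v : HeightOneSpectrum (𝓞 K), (Sum.inr v : Place K) ∉ Tx →
            galoisCohomology.localization ρ₀ (Sum.inr v) 1 x ∈ unramifiedSubgroup (GaloisRep.toLocal v ρ₀) 1) ∧
          ∀ T' : Finset (Place K), Tx ⊆ T' →
            (∑ v ∈ T', Sum.elim
              (fun w : InfinitePlace K => zmodToQmodZ n
                (localTatePairingZMod (ρ₀.tateDual n) n (Sum.inl w) (LocalInvariants.canonical K n (Sum.inl w))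
                  (readout ρ₀ n hM (IdeleReadout.ideleProjection K (Sum.inl w)) f)
                  (galoisCohomology.localization ((ρ₀.tateDual n).tateDual n) (Sum.inl w) 1
                    (galoisCohomology.map ι 1 x))))
              (fun v : HeightOneSpectrum (𝓞 K) =>
                haveI := moduleFinite_presModule₁ ρ₀
                haveI : CharZero (v.adicCompletion K) := charZero_of_algebra (K := K) (v.adicCompletion K);
                - brauerInvariantEquiv (v.adicCompletion K)
                  (cohomologyMap (toTopRepHom ((presModule₁ ρ₀).restrictField (v.adicCompletion K))
                      (DiscreteGaloisModule.units (v.adicCompletion K))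
                      (equivariantMap ((presModule₁ ρ₀).restrictField (v.adicCompletion K))
                        (DiscreteGaloisModule.units (v.adicCompletion K))
                        (readoutInvariant (IdeleReadout.ideleProjection K (Sum.inr v)) (presentationComplex ρ₀).X₁ f))) 2
                    (galoisCohomology.res (presModule₁ ρ₀) (v.adicCompletion K) 2 ((pres_isSES ρ₀).δ₁ x))))
              v) = 0 →
            classBarInv K (ŷ.comp (boundary (presentationComplex_shortExact ρ₀) (classBarD K)
              (f ≫ (ideleClassLimitShortComplex K).g)) (rfl : 1 + 1 = 2)) = 0)
    (n : ℕ) [NeZero n] : (LocalInvariants.canonical K n).SelmerComplement :=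
  selmerComplement_canonical_of_middleExact_allLevels n (middleExact_canonical_of_reciprocitySum hE n)

/-- **The FIVE-conjunct fact `poitouTate_selmerStructure_duality_real K` (the four properties AND injectivity at the real places)
from the sign-free reciprocity sum**, witnessed by the canonical family (`canonical_isPerfect`, `sumLocalTermEqZero_canonical`,
`unramifiedOrthogonal_of_isPerfect_allLevels`, `selmerComplement_canonical_of_reciprocitySum`, `canonical_injectiveAtRealPlaces`).
[cite: MilneADT2006, Ch. I, Thm. 4.10 (b), Ex. 1.6 (c), Thm. 2.13][cite: Howard2004HeegnerKolyvagin, Thm. 2.1.11 (arXiv:1202.6340 p. 6)] -/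
theorem poitouTate_selmerStructure_duality_real_of_reciprocitySum
    (hE : ∀ (n : ℕ) [NeZero n],
      ∀ ⦃M : Type⦄ [AddCommGroup M] [TopologicalSpace M] [DiscreteTopology M] [Finite M] [Finite (TateDual K M n)]
      (ρ₀ : DiscreteGaloisModule K M) (hM : ∀ m : M, n • m = 0)
      (ι : ρ₀.toContRepresentation →ⁱL ((ρ₀.tateDual n).tateDual n).toContRepresentation),
      (∀ (m : M) (f : TateDual K M n), ι m f = f m) →
      ∀ (f : (presentationComplex ρ₀).X₁ ⟶ (ideleClassLimitShortComplex K).X₂)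
        (ŷ : Abelian.Ext (triv (Γ := absoluteGaloisGroup K) ℤ) (presentationComplex ρ₀).X₃ 1) (T₀ : Finset (Place K)),
        ∃ (x : galoisCohomology ρ₀ 1) (Tx : Finset (Place K)), T₀ ⊆ Tx ∧
          (∀ v : HeightOneSpectrum (𝓞 K), (Sum.inr v : Place K) ∉ Tx →
            galoisCohomology.localization ρ₀ (Sum.inr v) 1 x ∈ unramifiedSubgroup (GaloisRep.toLocal v ρ₀) 1) ∧
          ∀ T' : Finset (Place K), Tx ⊆ T' →
            (∑ v ∈ T', Sum.elim
              (fun w : InfinitePlace K => zmodToQmodZ n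
                (localTatePairingZMod (ρ₀.tateDual n) n (Sum.inl w) (LocalInvariants.canonical K n (Sum.inl w))
                  (readout ρ₀ n hM (IdeleReadout.ideleProjection K (Sum.inl w)) f)
                  (galoisCohomology.localization ((ρ₀.tateDual n).tateDual n) (Sum.inl w) 1
                    (galoisCohomology.map ι 1 x))))
              (fun v : HeightOneSpectrum (𝓞 K) =>
                haveI := moduleFinite_presModule₁ ρ₀
                haveI : CharZero (v.adicCompletion K) := charZero_of_algebra (K := K) (v.adicCompletion K);
                - brauerInvariantEquiv (v.adicCompletion K)
                  (cohomologyMap (toTopRepHom ((presModule₁ ρ₀).restrictField (v.adicCompletion K))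
                      (DiscreteGaloisModule.units (v.adicCompletion K))
                      (equivariantMap ((presModule₁ ρ₀).restrictField (v.adicCompletion K))
                        (DiscreteGaloisModule.units (v.adicCompletion K))
                        (readoutInvariant (IdeleReadout.ideleProjection K (Sum.inr v)) (presentationComplex ρ₀).X₁ f))) 2
                    (galoisCohomology.res (presModule₁ ρ₀) (v.adicCompletion K) 2 ((pres_isSES ρ₀).δ₁ x))))
              v) = 0 →
            classBarInv K (ŷ.comp (boundary (presentationComplex_shortExact ρ₀) (classBarD K)
              (f ≫ (ideleClassLimitShortComplex K).g)) (rfl : 1 + 1 = 2)) = 0) :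
    poitouTate_selmerStructure_duality_real K := fun n _ =>
  ⟨LocalInvariants.canonical K n, LocalInvariants.canonical_isPerfect, sumLocalTermEqZero_canonical n,
    unramifiedOrthogonal_of_isPerfect_allLevels _ LocalInvariants.canonical_isPerfect,
    selmerComplement_canonical_of_reciprocitySum hE n, LocalInvariants.canonical_injectiveAtRealPlaces⟩

end Summit.BirchSwinnertonDyer.BirchSwinnertonDyer.Theorems.SchneiderFreeAdditiveX3.PoitouTateReduction

end
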